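/-
Copyright (c) 2026 the pub-hodgecm-mathlib formalisation cell (harness21).  Prover seat hodgecm-mathlib-K2E1b-p16 (g0),
Track B «K2-LIT» ∕ h413 (stmt-HodgeConjecture-24833), line K2_E1b «GKCohomologyU21», unit U6 «LEVEL-B PIN», file #18 (satellite):
`K`-FIXEDNESS OF `𝔨`-EQUIVARIANT DEGREE-ONE COCHAIN VALUES ALONG `K = exp 𝔨`, the general lemma consumed by
`Theorems/K2E1bClassEqArchDegOneOfPType.lean`.  2026-09-03.
-/
import Literature.NumberTheory.Automorphic.GKModulesAdCompatOfWeakDeriv   -- ★ `IsGKModule.expK_neg_smul`, `ExpOrbit.basisS∕coordS`, `AdCLM`, `expS`, `brS`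
import HarnessLib

/-!
# K2_E1b road (h413 = stmt-HodgeConjecture-24833), file #18 satellite: a `𝔨`-equivariant linear map `𝔤 → V` is `K`-equivariant on `exp 𝔨`

Cell `pub/hodgecm-mathlib` (D-0151), Track B; helper of `Theorems/K2E1bClassEqArchDegOneOfPType.lean` (socket #18
`sig_K2E1bClassEqArchDegOneOfPType` of `Cruxes/H413/Lines/K2_E1b_GKCohomologyU21_U456_Cohomology.lean`), split off to respect the 400-line rule.

THE MATHEMATICS (Borel–Wallach 0 §2.5 ∕ I §5.1: for connected `K` the `K`-fixed relative cochains are the `𝔨`-invariant ones,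
`C^q(𝔤, K; V) = C^q(𝔤, 𝔨; V)`; here the degree-one, value-level form).  Let `G` be ANY linear real group of the tree (`RealMatrixGroup`),
`ρK` a `K`-action and `ρ𝔤` a `𝔤`-action on a complex vector space `V` with the weak derivative along `𝔨`
(`d/dt|₀ ℓ (ρK (exp tY) v) = ℓ (ρ𝔤 Y v)`, the axiom ★ `IsGKModule.hasWeakDeriv`), and `f : 𝔤 → V` an `ℝ`-linear map with
`f ⁅Y, X⁆ = ρ𝔤(Y) f(X)` for `Y ∈ 𝔨`.  Then:
* `hasDerivAt_twistCoeff_zero` — the twisted coefficient `s ↦ ℓ (ρK (exp sY)⁻¹ (f (Ad (exp sY) X)))` has derivative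
  `ℓ (f ⁅Y, X⁆) − ℓ (ρ𝔤 Y (f X)) = 0` at `s = 0` (product rule in coordinates of the finite-dimensional `𝔤`; ★ `hasDerivAt_AdCLM_expS_smul`);
* `twistCoeff_eq` — by the one-parameter group law the derivative vanishes everywhere, so the coefficient is constant (`= ℓ (f X)`);
* **`apply_Ad_of_expK_surjective`** — `f (Ad k X) = ρK k (f X)` for every `k ∈ K` as soon as `exp : 𝔨 → K` is onto (e.g.
  `K = U(α) × U(β) ⊂ U(α, β)`, ★ `upq_expK_surjective`), since functionals separate points.
This is the argument of ★ `GKModulesAdCompatOfWeakDeriv` (`Ad`-compatibility from the weak derivative) with `f` in place of `ρ𝔤`; no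
`K`-finiteness is needed because `f` takes values in the finite-dimensional `f(𝔤)`.

HONEST LABEL: HC_CM is proved only modulo the 7 printed citations (2 remaining named inputs: hLiu418 = stmt-HodgeConjecture-24832,
h413 = stmt-HodgeConjecture-24833) until rung 0 closes; this file is a `--supports stmt-HodgeConjecture-24833` helper and retires nothing by itself.

## References
* [BorelWallach2000] A. Borel, N. Wallach, *Continuous cohomology, discrete subgroups, and representations of reductive groups*, 2nd ed.,
  Math. Surveys Monogr. 67, AMS (2000), 0 §2.5; I §5.1 (1)–(3).
* [KnappVogan1995] A. W. Knapp, D. A. Vogan, *Cohomological Induction and Unitary Representations*, Princeton (1995), §I.4 (1.64)–(1.65).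
-/

set_option autoImplicit false
-- the mandated namespace repeats the single-problem summit's segment (`HodgeConjecture.HodgeConjecture`)
set_option linter.dupNamespace false

-- Mathlib idiom (as in `GKModules`, `GKCohomology`, ★ `GKModulesAdCompatOfWeakDeriv`): commutator bracket on `Module.End` ∕ matrices
attribute [local instance 100] LieRing.ofAssociativeRing

-- the scoped `L^∞`-operator norm on matrices, as in ★ `GKModulesSmoothVectorsProofs` (`expS`, `AdCLM`)
open scoped Matrix.Norms.Operator
open Module

noncomputable section

namespace Summit.HodgeConjecture.HodgeConjecture.Cruxes.H413.K2E1bClassEqArchDegOneOfPTypeKFixed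

open Literature.NumberTheory.Automorphic

section KEquivariance

variable {A : Type*} [NormedCommRing A] [NormedAlgebra ℝ A] [NormedAlgebra ℚ A] [CompleteSpace A]
  [StarRing A] [StarModule ℝ A] [ContinuousStar A] [FiniteDimensional ℝ A] {N : Type*} [Fintype N] [DecidableEq N]
  {G : RealMatrixGroup A N}
  {V : Type*} [AddCommGroup V] [Module ℂ V]
  {ρK : Representation ℂ G.maximalCompact V} {ρ𝔤 : G.lie →ₗ⁅ℝ⁆ Module.End ℂ V}
  (hD : ∀ (Y : G.compactLie) (v : V) (ℓ : Module.Dual ℂ V),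
    HasDerivAt (fun t : ℝ ↦ ℓ (ρK (G.expK (t • Y)) v)) (ℓ (ρ𝔤 (LieSubalgebra.inclusion G.compactLie_le_lie Y) v)) 0)
  {f : G.lie →ₗ[ℝ] V}
  (hf : ∀ (Y : G.compactLie) (X : G.lie),
    f ⁅LieSubalgebra.inclusion G.compactLie_le_lie Y, X⁆ = ρ𝔤 (LieSubalgebra.inclusion G.compactLie_le_lie Y) (f X))
include hD hf

/-- Core computation: for a `𝔨`-equivariant `ℝ`-linear `f : 𝔤 → V`, the twisted coefficient
`s ↦ ℓ (ρK (exp sY)⁻¹ (f (Ad (exp sY) X)))` has derivative `ℓ (f ⁅Y, X⁆ − ρ𝔤 Y (f X)) = 0` at `s = 0`.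
[cite: BorelWallach2000, 0 §2.5; I §5.1] -/
theorem hasDerivAt_twistCoeff_zero (Y : G.compactLie) (X : G.lie) (ℓ : Module.Dual ℂ V) :
    HasDerivAt (fun s : ℝ ↦ ℓ (ρK (G.expK (s • Y))⁻¹
      (f (G.Ad (Subgroup.inclusion G.maximalCompact_le_carrier (G.expK (s • Y))) X)))) 0 0 := by
  set Yg : G.lie := LieSubalgebra.inclusion G.compactLie_le_lie Y with hYg
  set Ys : G.lie.toSubmodule := ⟨(Y : Matrix N N A), G.compactLie_le_lie Y.2⟩ with hYs
  let ι : G.lie.toSubmodule →ₗ[ℝ] G.lie :=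
    { toFun := fun Z ↦ ⟨(Z : Matrix N N A), Z.2⟩
      map_add' := fun _ _ ↦ rfl
      map_smul' := fun _ _ ↦ rfl }
  set Xs : G.lie.toSubmodule := ⟨(X : Matrix N N A), X.2⟩ with hXs
  have hιX : ι Xs = X := rfl
  have hrecf : ∀ Z : G.lie.toSubmodule, f (ι Z) = ∑ j, ExpOrbit.coordS G j Z • f (ι (ExpOrbit.basisS G j)) := by
    intro Z
    conv_lhs => rw [← (ExpOrbit.basisS G).sum_repr Z]
    simp only [map_sum, map_smul, ExpOrbit.coordS_apply]
  have hrecfℓ : ∀ (Z : G.lie.toSubmodule) (μ : Module.Dual ℂ V),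
      μ (f (ι Z)) = ∑ j, ExpOrbit.coordS G j Z • μ (f (ι (ExpOrbit.basisS G j))) := by
    intro Z μ
    rw [hrecf Z, map_sum]
    simp only [LinearMap.map_smul_of_tower]
  have hc : ∀ j, HasDerivAt (fun s : ℝ ↦ ExpOrbit.coordS G j (G.AdCLM (G.expS (s • Ys)) Xs))
      (ExpOrbit.coordS G j (G.brS Ys Xs)) 0 :=
    fun j ↦ (ExpOrbit.coordS G j).hasFDerivAt.comp_hasDerivAt 0 (G.hasDerivAt_AdCLM_expS_smul Ys Xs)
  have hd : ∀ w : V, HasDerivAt (fun s : ℝ ↦ ℓ (ρK (G.expK (s • Y))⁻¹ w)) (-ℓ (ρ𝔤 Yg w)) 0 := by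
    intro w
    have h := hD (-Y) w ℓ
    have h1 : (fun t : ℝ ↦ ℓ (ρK (G.expK (t • -Y)) w)) = fun s : ℝ ↦ ℓ (ρK (G.expK (s • Y))⁻¹ w) := by
      funext s
      rw [smul_neg, ← neg_smul, IsGKModule.expK_neg_smul]
    have h2 : ℓ (ρ𝔤 (LieSubalgebra.inclusion G.compactLie_le_lie (-Y)) w) = -ℓ (ρ𝔤 Yg w) := by
      rw [map_neg, map_neg, LinearMap.neg_apply, map_neg]
    rw [h1, h2] at h
    exact h
  have hAd : ∀ s : ℝ, G.Ad (Subgroup.inclusion G.maximalCompact_le_carrier (G.expK (s • Y))) X =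
      ι (G.AdCLM (G.expS (s • Ys)) Xs) := fun s ↦ Subtype.ext rfl
  have hfun : (fun s : ℝ ↦ ℓ (ρK (G.expK (s • Y))⁻¹
      (f (G.Ad (Subgroup.inclusion G.maximalCompact_le_carrier (G.expK (s • Y))) X)))) =
      fun s : ℝ ↦ ∑ j, ExpOrbit.coordS G j (G.AdCLM (G.expS (s • Ys)) Xs) •
        ℓ (ρK (G.expK (s • Y))⁻¹ (f (ι (ExpOrbit.basisS G j)))) := by
    funext s
    rw [hAd s]
    have h := hrecfℓ (G.AdCLM (G.expS (s • Ys)) Xs) (ℓ ∘ₗ ρK (G.expK (s • Y))⁻¹)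
    simp only [LinearMap.coe_comp, Function.comp_apply] at h
    exact h
  rw [hfun]
  have hsum := HasDerivAt.fun_sum (u := Finset.univ) fun j _ ↦
    (hc j).fun_smul (hd (f (ι (ExpOrbit.basisS G j))))
  have h0K : G.expK ((0 : ℝ) • Y) = 1 := RealMatrixGroup.expK_zero_smul Y
  have h0S : G.AdCLM (G.expS ((0 : ℝ) • Ys)) Xs = Xs := by
    rw [zero_smul, RealMatrixGroup.expS_zero, RealMatrixGroup.AdCLM_one, ContinuousLinearMap.id_apply]
  simp only [h0K, h0S, inv_one, map_one, Module.End.one_apply] at hsum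
  have hbr : ι (G.brS Ys Xs) = ⁅Yg, X⁆ := by
    apply Subtype.ext
    rw [LieSubalgebra.coe_bracket, Ring.lie_def]
    rfl
  have h1 : ∑ j, ExpOrbit.coordS G j Xs • -ℓ (ρ𝔤 Yg (f (ι (ExpOrbit.basisS G j)))) = -ℓ (ρ𝔤 Yg (f X)) := by
    have h := hrecfℓ Xs (ℓ ∘ₗ ρ𝔤 Yg)
    simp only [LinearMap.coe_comp, Function.comp_apply, hιX] at h
    rw [h, ← Finset.sum_neg_distrib]
    exact Finset.sum_congr rfl fun j _ ↦ by rw [smul_neg]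
  have h2 : ∑ j, ExpOrbit.coordS G j (G.brS Ys Xs) • ℓ (f (ι (ExpOrbit.basisS G j))) = ℓ (f ⁅Yg, X⁆) := by
    rw [← hrecfℓ, hbr]
  refine hsum.congr_deriv ?_
  rw [Finset.sum_add_distrib, h1, h2, hf Y X, neg_add_cancel]

/-- **The twisted coefficient is constant**: `ℓ (ρK (exp tY)⁻¹ (f (Ad (exp tY) X))) = ℓ (f X)` for all `t`
(one-parameter group law: the derivative at `t` is the derivative at `0` for the data `(Ad (exp tY) X, ℓ ∘ ρK (exp tY)⁻¹)`).
[cite: BorelWallach2000, 0 §2.5; I §5.1] -/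
theorem twistCoeff_eq (Y : G.compactLie) (X : G.lie) (ℓ : Module.Dual ℂ V) (t : ℝ) :
    ℓ (ρK (G.expK (t • Y))⁻¹ (f (G.Ad (Subgroup.inclusion G.maximalCompact_le_carrier (G.expK (t • Y))) X))) =
      ℓ (f X) := by
  set g : ℝ → ℂ := fun t ↦ ℓ (ρK (G.expK (t • Y))⁻¹
    (f (G.Ad (Subgroup.inclusion G.maximalCompact_le_carrier (G.expK (t • Y))) X))) with hg
  have hderiv : ∀ t : ℝ, HasDerivAt g 0 t := by
    intro t
    set kt := G.expK (t • Y) with hkt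
    have h0 := hasDerivAt_twistCoeff_zero hD hf Y
      (G.Ad (Subgroup.inclusion G.maximalCompact_le_carrier kt) X) (ℓ ∘ₗ ρK kt⁻¹)
    have h1 : (fun s : ℝ ↦ (ℓ ∘ₗ ρK kt⁻¹) (ρK (G.expK (s • Y))⁻¹
        (f (G.Ad (Subgroup.inclusion G.maximalCompact_le_carrier (G.expK (s • Y)))
          (G.Ad (Subgroup.inclusion G.maximalCompact_le_carrier kt) X))))) =
        fun s : ℝ ↦ g (t + s) := by
      funext s
      simp only [hg, LinearMap.coe_comp, Function.comp_apply]
      rw [add_comm, RealMatrixGroup.expK_add_smul, mul_inv_rev, map_mul, map_mul, RealMatrixGroup.Ad_mul]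
      rfl
    rw [h1] at h0
    have h2 := HasDerivAt.comp_sub_const (f := fun s : ℝ ↦ g (t + s)) t t (by rwa [sub_self])
    refine h2.congr_of_eventuallyEq (Filter.Eventually.of_forall fun u ↦ ?_)
    simp only [add_sub_cancel]
  have hconst := is_const_of_deriv_eq_zero (fun t ↦ (hderiv t).differentiableAt)
    (fun t ↦ (hderiv t).deriv) t 0
  have hg0 : g 0 = ℓ (f X) := by
    simp only [hg, RealMatrixGroup.expK_zero_smul, inv_one, map_one, Module.End.one_apply,
      RealMatrixGroup.Ad_one, LieHom.id_apply]
  rw [← hg0, ← hconst]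

/-- **`K`-equivariance on `K = exp 𝔨`**: if every element of `K` is an exponential (e.g. `U(α) × U(β) ⊂ U(α, β)`), a `𝔨`-equivariant
`ℝ`-linear `f : 𝔤 → V` satisfies `f (Ad k X) = ρK k (f X)` for all `k ∈ K` (functionals separate points). [cite: BorelWallach2000, 0 §2.5; I §5.1] -/
theorem apply_Ad_of_expK_surjective (hK : Function.Surjective G.expK) (k : G.maximalCompact) (X : G.lie) :
    f (G.Ad (Subgroup.inclusion G.maximalCompact_le_carrier k) X) = ρK k (f X) := by
  obtain ⟨Y, rfl⟩ := hK k
  have h1 : G.expK Y = G.expK ((1 : ℝ) • Y) := by rw [one_smul]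
  have hkk : ∀ w, ρK (G.expK Y) (ρK (G.expK Y)⁻¹ w) = w := fun w ↦ by
    rw [← Module.End.mul_apply, ← map_mul, mul_inv_cancel, map_one, Module.End.one_apply]
  have h2 : ρK (G.expK Y)⁻¹ (f (G.Ad (Subgroup.inclusion G.maximalCompact_le_carrier (G.expK Y)) X)) = f X := by
    rw [← sub_eq_zero, ← forall_dual_apply_eq_zero_iff ℂ]
    intro ℓ
    rw [map_sub, sub_eq_zero, h1]
    exact twistCoeff_eq hD hf Y X ℓ 1
  rw [← hkk (f (G.Ad (Subgroup.inclusion G.maximalCompact_le_carrier (G.expK Y)) X)), h2]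

end KEquivariance

end Summit.HodgeConjecture.HodgeConjecture.Cruxes.H413.K2E1bClassEqArchDegOneOfPTypeKFixed

end
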